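import Summits.HodgeConjecture.HodgeConjecture.Theorems.Ring2WeilCoverageWeilGramCMPoint
import Summits.HodgeConjecture.HodgeConjecture.Theorems.Ring2WeilCoverageCyclotomicUnconditional
import Summits.HodgeConjecture.HodgeConjecture.Theorems.Ring2WeilCoverageRealUnitNormHalfSystems
import Summits.HodgeConjecture.HodgeConjecture.Theorems.Ring2WeilCoverageNormTable
import Mathlib.Tactic.ComputeDegree
import HarnessLib

/-!
# Weil-type family coverage — THE COMPONENTS OF THE WEIL-TYPE `ℤ[ζ₂₁]`-SIXFOLDS, I: level lemmas, the evaluation step, and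
# the principal-type form `(E_ξ, √−3)`: van Geemen Gram determinant `det a = 1728 = 3·24² > 0` in the real frame
# `1, θ, …, θ⁵` of `ℚ(ζ₂₁)⁺` — the WRONG sign for Weil signature `(3,3)` (the census NO row `(21, ℚ(√−3))`)

research route conditional on HC_CM; not a corollary; Q11.4-sentence-2 already refuted in dim ≥ 3.

Ring 2, WEIL-TYPE FAMILY-COVERAGE CENSUS (`HOME/WEIL-FAMILY-COVERAGE.md` `## b01`, block b01.41 (C) «COMPONENTS (S-pencil,
exact)» at `g = 6` and b01.47 (E) «NOT CLAIMED: the `g = 6` placements of b01.41 (C)»; owner ring2-b01), part 98 of the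
`Ring2WeilCoverage*` series: the `g = 6` edition of parts 83/87/89 (`K = ℚ(ζ₂₁)`, `g = 6`, `n = 3`, `ξ = ζ⁵/Φ₂₁′(ζ)` the
census generator of `𝔡⁻¹`, real frame `xᵢ = θ^i`, `θ = ζ + ζ⁻¹`, `i < 6`).  For a skew `ζ′` and a skew `s` with `s² = −d`
part 82 (`Ring2WeilCoverageWeilGramCMPoint`) shows that the Gram matrix `Ψ = a + b√−d` of van Geemen's hermitian form
`H = E(x, sy) + √−d E(x, y)`, `E = E_ζ′ = Tr_{K/ℚ}(ζ′xȳ)`, in a real frame is the rational matrix `a = (−Tr(ζ′s xᵢxⱼ))`,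
`b = 0`, with `det a = (−2)^g N_{K⁺/ℚ}(ζ′s) disc(ω)`; for `n = 3` the split class is `[−1]·Nm` and a `Φ`-positive `ζ′` on
a Weil-type (`(3,3)`) CM type has `(−1)³ det a > 0` (part 92).

* §0 level lemmas: `Φ₂₁(ζ) = 0` written out, `θζ = ζ² + 1`, `s₃ = 1 + 2ζ⁷` is skew with `s₃² = −3`, `ξ` skew; §0b the
  evaluation step `Tr(y θ^m) = coeff₁₁(R)` from a certificate `y(ζ² + 1)^m = R(ζ)Φ′(ζ)⁻¹ζ^m` (part 81, Euler).
* §1 the eleven traces `Tr(ξ s₃ θ^m)`, `m ≤ 10`, and the Gram datum: **`a = −(Tr(ξ s₃ θ^{i+j}))`, `det a = 1728 = 3·24²`**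
  — POSITIVE, so `(−1)³ det a < 0`: by [vG94 5.2 (4)] no principal-type `E_ζ′` is a polarisation on a `ℚ(√−3)`-Weil-type
  CM type (part 99 `Ring2WeilCoverageWeilGramLevel21Principal` turns this into the NO-row theorem; parts 100–103: the
  YES row `ℚ(√−7)`, the types `𝔮₃`, `(4 + √21)` → R2, `(2 + √21)`).

HONEST FRAMING as parts 82–97: kernel statements about traces in `ℚ(ζ₂₁)` and the rational Gram matrices `(a, b)` of
part 82 (hypotheses `ha`); the census ROW words are the reading of the class `[det a]` by [vG94 Lemma 5.2 (3), (5.4.1)];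
nothing about Hodge classes, `W_K`, general members or HC; `HC_CM` is used nowhere.  No `def`, no named fact, no
`sorry`.  Certificates produced by `work/py/gen6.py` + `lev21.py` (exact arithmetic in `ℚ[x]/Φ₂₁`, stdlib) and
re-verified here by `linear_combination`.

References: [cite: vanGeemen1994HodgeAV, Lemma 5.2 (2)–(4), 5.4 and (5.4.1)]; [cite: Shimura1998, §14.3 Prop. 4–5,
pp. 103–104]; [cite: NeukirchANT1999, Ch. III (2.4)] (Euler); census b01.41 (C) (seat-derived).
-/

noncomputable section

open Polynomial NumberField Module
open scoped nonZeroDivisors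

namespace Summit.HodgeConjecture.Ring2WeilCoverage.WeilGramLevel21

open Literature.AlgebraicGeometry.VanGeemen1994 (weilField weilNormResidueGroup)
open Literature.AlgebraicGeometry.Motives (CMType normUnitsSubgroup)
open Literature.NumberTheory.ComplexMultiplication
open Summit.HodgeConjecture.Ring2WeilCoverage.TraceGramDeterminant (trace_aeval_zeta_mul_inv)
open Summit.HodgeConjecture.Ring2WeilCoverage.WeilGramCMPoint
open Summit.HodgeConjecture.Ring2WeilCoverage.RealUnitNormHalfSystems (complexConj_eq_inv)
open Summit.HodgeConjecture.Ring2WeilCoverage.CyclotomicPrincipalObstruction (complexConj_xi)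
open Summit.HodgeConjecture.Ring2WeilCoverage.CyclotomicDifferent (isOfType_one_xi_top xi_ne_zero)
open Summit.HodgeConjecture.HodgeConjecture.Ring2.WeilCoverage (mk_neg_eq_split_of_odd mk_neg_ne_split_of_odd
  mem_normUnitsSubgroup_of_sq_add_mul_sq)
open Summit.HodgeConjecture.HodgeConjecture.Ring2.Hypotheses (splitDiscriminantClass)
variable {K : Type} [Field K] [NumberField K] {ζ : K}

/-! ### §0 Level lemmas -/

omit [NumberField K] in
/-- **`Φ₂₁(ζ) = 0` written out**: `ζ¹² − ζ¹¹ + ζ⁹ − ζ⁸ + ζ⁶ − ζ⁴ + ζ³ − ζ + 1 = 0`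
(`(x⁷ − 1)(x² + x + 1)Φ₂₁(x) = x²¹ − 1`, `ζ⁷ ≠ 1`, `ζ³ ≠ 1`). research route conditional on HC_CM; not a corollary; Q11.4-sentence-2 already refuted in dim ≥ 3. [folklore] -/
theorem cyc_twentyOne (hζ : IsPrimitiveRoot ζ 21) :
    ζ ^ 12 - ζ ^ 11 + ζ ^ 9 - ζ ^ 8 + ζ ^ 6 - ζ ^ 4 + ζ ^ 3 - ζ + 1 = 0 := by
  have h21 : ζ ^ 21 = 1 := hζ.pow_eq_one
  have h7 : ζ ^ 7 - 1 ≠ 0 := sub_ne_zero.mpr (hζ.pow_ne_one_of_pos_of_lt (by norm_num) (by norm_num))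
  have h3 : ζ ^ 3 ≠ 1 := hζ.pow_ne_one_of_pos_of_lt (by norm_num) (by norm_num)
  have h2 : ζ ^ 2 + ζ + 1 ≠ 0 := by
    intro h
    apply h3
    linear_combination (ζ - 1) * h
  have h : (ζ ^ 7 - 1) * (ζ ^ 2 + ζ + 1) * (ζ ^ 12 - ζ ^ 11 + ζ ^ 9 - ζ ^ 8 + ζ ^ 6 - ζ ^ 4 + ζ ^ 3 - ζ + 1) = 0 := by
    linear_combination h21
  rcases mul_eq_zero.mp h with h' | h'
  · exact absurd h' (mul_ne_zero h7 h2)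
  · exact h'

omit [NumberField K] in
/-- `θζ = ζ² + 1` for `θ = ζ + ζ⁻¹`. [folklore] -/
theorem theta_mul_zeta (hζ : IsPrimitiveRoot ζ 21) : (ζ + ζ⁻¹) * ζ = ζ ^ 2 + 1 := by
  have hζ0 : ζ ≠ 0 := hζ.ne_zero (by norm_num)
  rw [add_mul, inv_mul_cancel₀ hζ0]
  ring

omit [NumberField K] in
/-- `(ζ⁻¹)^a = ζ^b` when `a + b = 21`. [folklore] -/
theorem inv_pow_eq_pow (hζ : IsPrimitiveRoot ζ 21) {a b : ℕ} (hab : a + b = 21) : ζ⁻¹ ^ a = ζ ^ b := by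
  rw [inv_pow]
  apply inv_eq_of_mul_eq_one_right
  rw [← pow_add, hab, hζ.pow_eq_one]

/-- `θ = ζ + ζ⁻¹` is real. [folklore] -/
theorem complexConj_theta [IsCMField K] (hζ : IsPrimitiveRoot ζ 21) :
    IsCMField.complexConj K (ζ + ζ⁻¹) = ζ + ζ⁻¹ := by
  rw [map_add, map_inv₀, complexConj_eq_inv hζ, inv_inv, add_comm]

/-- The frame `xᵢ = θ^i` is real. [folklore] -/
theorem complexConj_thetaFrame [IsCMField K] (hζ : IsPrimitiveRoot ζ 21) {m : ℕ} {x : Fin m → K}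
    (hx : ∀ i, x i = (ζ + ζ⁻¹) ^ (i : ℕ)) (i : Fin m) : IsCMField.complexConj K (x i) = x i := by
  rw [hx i, map_pow, complexConj_theta hζ]

/-- `ξ = ζ⁵/Φ′(ζ)` is skew (part 7, `g − 1 = 5`). [folklore] -/
theorem complexConj_xi_twentyOne [IsCMField K] (hζ : IsPrimitiveRoot ζ 21) :
    IsCMField.complexConj K (ζ ^ 5 * (aeval ζ (derivative (cyclotomic 21 ℚ)))⁻¹) =
      -(ζ ^ 5 * (aeval ζ (derivative (cyclotomic 21 ℚ)))⁻¹) :=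
  complexConj_xi hζ (k := 5) (by decide)

omit [NumberField K] in
/-- **`(1 + 2ζ⁷)² = −3`**: `s = √−3 = 1 + 2ζ⁷` generates `K_d = ℚ(√−3) ⊂ ℚ(ζ_21)`. [folklore] -/
theorem sq_sqrtNegThree (hζ : IsPrimitiveRoot ζ 21) : (1 + 2 * ζ ^ 7) ^ 2 = -3 := by
  linear_combination (4 + 4 * ζ + 4 * ζ^2) * cyc_twentyOne hζ

/-- **`s = √−3 = 1 + 2ζ⁷` is skew** (`s^ρ = −s`). [folklore] -/
theorem complexConj_sqrtNegThree [IsCMField K] (hζ : IsPrimitiveRoot ζ 21) :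
    IsCMField.complexConj K (1 + 2 * ζ ^ 7) = -(1 + 2 * ζ ^ 7) := by
  simp only [map_add, map_mul, map_pow, map_one, map_ofNat, complexConj_eq_inv hζ]
  rw [inv_pow_eq_pow hζ (show 7 + 14 = 21 by norm_num)]
  linear_combination (2 + 2 * ζ + 2 * ζ^2) * cyc_twentyOne hζ


/-! ### §0b The evaluation step: `Tr(y·θ^m)` from a certificate `y(ζ² + 1)^m = R(ζ)Φ′(ζ)⁻¹ζ^m` (part 81) -/

/-- Evaluation of an explicit polynomial of degree `≤ 11` at `ζ`. [folklore] -/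
theorem aeval_poly₁₂ (ζ : K) (c₀ c₁ c₂ c₃ c₄ c₅ c₆ c₇ c₈ c₉ c₁₀ c₁₁ : ℚ) :
    aeval ζ (C c₀ + C c₁ * X + C c₂ * X ^ 2 + C c₃ * X ^ 3 + C c₄ * X ^ 4 + C c₅ * X ^ 5 + C c₆ * X ^ 6 + C c₇ * X ^ 7 +
        C c₈ * X ^ 8 + C c₉ * X ^ 9 + C c₁₀ * X ^ 10 + C c₁₁ * X ^ 11) =
      (c₀ : K) + (c₁ : K) * ζ + (c₂ : K) * ζ ^ 2 + (c₃ : K) * ζ ^ 3 + (c₄ : K) * ζ ^ 4 + (c₅ : K) * ζ ^ 5 +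
        (c₆ : K) * ζ ^ 6 + (c₇ : K) * ζ ^ 7 + (c₈ : K) * ζ ^ 8 + (c₉ : K) * ζ ^ 9 + (c₁₀ : K) * ζ ^ 10 +
        (c₁₁ : K) * ζ ^ 11 := by
  simp only [map_add, map_mul, map_pow, aeval_C, aeval_X, eq_ratCast]

/-- `Tr_{K/ℚ}(y) = coeff₁₁(R)` if `y = R(ζ)/Φ′(ζ)` with `deg R ≤ 11` (part 81 `trace_aeval_zeta_mul_inv`). research route conditional on HC_CM; not a corollary; Q11.4-sentence-2 already refuted in dim ≥ 3. [folklore] -/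
theorem trace_of_key₀ [IsCyclotomicExtension {21} ℚ K] (hζ : IsPrimitiveRoot ζ 21) {y : K} (R : ℚ[X])
    (hR : R.natDegree ≤ 11) (hkey : y = aeval ζ R * (aeval ζ (derivative (cyclotomic 21 ℚ)))⁻¹) :
    Algebra.trace ℚ K y = R.coeff 11 := by
  have hφ : Nat.totient 21 = 12 := by decide
  rw [hkey, trace_aeval_zeta_mul_inv hζ R (by rw [hφ]; omega), hφ]

/-- `Tr_{K/ℚ}(y·θ) = coeff₁₁(R)` if `y(ζ² + 1) = R(ζ)Φ′(ζ)⁻¹·ζ` (`θζ = ζ² + 1`). research route conditional on HC_CM; not a corollary; Q11.4-sentence-2 already refuted in dim ≥ 3. [folklore] -/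
theorem trace_of_key₁ [IsCyclotomicExtension {21} ℚ K] (hζ : IsPrimitiveRoot ζ 21) {y : K} (R : ℚ[X])
    (hR : R.natDegree ≤ 11) (hkey : y * (ζ ^ 2 + 1) = aeval ζ R * (aeval ζ (derivative (cyclotomic 21 ℚ)))⁻¹ * ζ) :
    Algebra.trace ℚ K (y * (ζ + ζ⁻¹)) = R.coeff 11 := by
  have hζ0 : ζ ≠ 0 := hζ.ne_zero (by norm_num)
  refine trace_of_key₀ hζ R hR (mul_right_cancel₀ hζ0 ?_)
  rw [mul_assoc, theta_mul_zeta hζ, hkey]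

/-- `Tr_{K/ℚ}(y·θ^m) = coeff₁₁(R)` if `y(ζ² + 1)^m = R(ζ)Φ′(ζ)⁻¹·ζ^m` (`θ^m ζ^m = (ζ² + 1)^m`). research route conditional on HC_CM; not a corollary; Q11.4-sentence-2 already refuted in dim ≥ 3. [folklore] -/
theorem trace_of_key [IsCyclotomicExtension {21} ℚ K] (hζ : IsPrimitiveRoot ζ 21) {y : K} {m : ℕ} (R : ℚ[X])
    (hR : R.natDegree ≤ 11) (hkey : y * (ζ ^ 2 + 1) ^ m = aeval ζ R * (aeval ζ (derivative (cyclotomic 21 ℚ)))⁻¹ * ζ ^ m) :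
    Algebra.trace ℚ K (y * (ζ + ζ⁻¹) ^ m) = R.coeff 11 := by
  have hζ0 : ζ ≠ 0 := hζ.ne_zero (by norm_num)
  refine trace_of_key₀ hζ R hR (mul_right_cancel₀ (pow_ne_zero m hζ0) ?_)
  rw [mul_assoc, ← mul_pow, theta_mul_zeta hζ, hkey]

/-! ### §1 The principal-type form `(E_ξ, s₃)`: eleven traces, the `6 × 6` Hankel matrix, `det a = 1728` -/

/-- `Tr(ζ′sθ^0) = 2` for `ζ′ = ξ = ζ⁵/Φ₂₁′(ζ)`, `s = √−3 = 1 + 2ζ⁷`, `θ = ζ + ζ⁻¹` (Euler evaluation). research route conditional on HC_CM; not a corollary; Q11.4-sentence-2 already refuted in dim ≥ 3. [folklore] -/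
theorem trace_xi_sqrtNegThree_zero [IsCyclotomicExtension {21} ℚ K] (hζ : IsPrimitiveRoot ζ 21) :
    Algebra.trace ℚ K ((ζ ^ 5 * (aeval ζ (derivative (cyclotomic 21 ℚ)))⁻¹) * (1 + 2 * ζ ^ 7)) = 2 := by
  have hΦ := cyc_twentyOne hζ
  rw [trace_of_key₀ hζ (C (-2 : ℚ) + C (2 : ℚ) * X + C (0 : ℚ) * X ^ 2 + C (-2 : ℚ) * X ^ 3 + C (2 : ℚ) * X ^ 4 +
      C (1 : ℚ) * X ^ 5 + C (-2 : ℚ) * X ^ 6 + C (0 : ℚ) * X ^ 7 + C (2 : ℚ) * X ^ 8 + C (-2 : ℚ) * X ^ 9 +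
      C (0 : ℚ) * X ^ 10 + C (2 : ℚ) * X ^ 11) (by compute_degree) (by
    rw [aeval_poly₁₂]
    push_cast
    linear_combination ((aeval ζ (derivative (cyclotomic 21 ℚ)))⁻¹ * (2)) * hΦ)]
  norm_num [coeff_X_pow, coeff_X, coeff_C, coeff_one]

/-- `Tr(ζ′sθ^1) = 4` for `ζ′ = ξ = ζ⁵/Φ₂₁′(ζ)`, `s = √−3 = 1 + 2ζ⁷`, `θ = ζ + ζ⁻¹` (Euler evaluation). research route conditional on HC_CM; not a corollary; Q11.4-sentence-2 already refuted in dim ≥ 3. [folklore] -/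
theorem trace_xi_sqrtNegThree_one [IsCyclotomicExtension {21} ℚ K] (hζ : IsPrimitiveRoot ζ 21) :
    Algebra.trace ℚ K ((ζ ^ 5 * (aeval ζ (derivative (cyclotomic 21 ℚ)))⁻¹) * (1 + 2 * ζ ^ 7) * (ζ + ζ⁻¹)) = 4 := by
  have hΦ := cyc_twentyOne hζ
  rw [trace_of_key₁ hζ (C (-2 : ℚ) + C (0 : ℚ) * X + C (2 : ℚ) * X ^ 2 + C (-2 : ℚ) * X ^ 3 + C (1 : ℚ) * X ^ 4 +
      C (2 : ℚ) * X ^ 5 + C (-1 : ℚ) * X ^ 6 + C (-2 : ℚ) * X ^ 7 + C (2 : ℚ) * X ^ 8 + C (0 : ℚ) * X ^ 9 +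
      C (-2 : ℚ) * X ^ 10 + C (4 : ℚ) * X ^ 11) (by compute_degree) (by
    rw [aeval_poly₁₂]
    push_cast
    linear_combination ((aeval ζ (derivative (cyclotomic 21 ℚ)))⁻¹ * (2 * ζ + 2 * ζ^2)) * hΦ)]
  norm_num [coeff_X_pow, coeff_X, coeff_C, coeff_one]

/-- `Tr(ζ′sθ^2) = 4` for `ζ′ = ξ = ζ⁵/Φ₂₁′(ζ)`, `s = √−3 = 1 + 2ζ⁷`, `θ = ζ + ζ⁻¹` (Euler evaluation). research route conditional on HC_CM; not a corollary; Q11.4-sentence-2 already refuted in dim ≥ 3. [folklore] -/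
theorem trace_xi_sqrtNegThree_two [IsCyclotomicExtension {21} ℚ K] (hζ : IsPrimitiveRoot ζ 21) :
    Algebra.trace ℚ K ((ζ ^ 5 * (aeval ζ (derivative (cyclotomic 21 ℚ)))⁻¹) * (1 + 2 * ζ ^ 7) * (ζ + ζ⁻¹) ^ 2) = 4 := by
  have hΦ := cyc_twentyOne hζ
  rw [trace_of_key hζ (C (-6 : ℚ) + C (4 : ℚ) * X + C (0 : ℚ) * X ^ 2 + C (-3 : ℚ) * X ^ 3 + C (4 : ℚ) * X ^ 4 +
      C (2 : ℚ) * X ^ 5 + C (-4 : ℚ) * X ^ 6 + C (-1 : ℚ) * X ^ 7 + C (4 : ℚ) * X ^ 8 + C (-4 : ℚ) * X ^ 9 +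
      C (2 : ℚ) * X ^ 10 + C (4 : ℚ) * X ^ 11) (by compute_degree) (by
    rw [aeval_poly₁₂]
    push_cast
    linear_combination ((aeval ζ (derivative (cyclotomic 21 ℚ)))⁻¹ * (6 * ζ^2 + 2 * ζ^3 + 2 * ζ^4)) * hΦ)]
  norm_num [coeff_X_pow, coeff_X, coeff_C, coeff_one]

/-- `Tr(ζ′sθ^3) = 12` for `ζ′ = ξ = ζ⁵/Φ₂₁′(ζ)`, `s = √−3 = 1 + 2ζ⁷`, `θ = ζ + ζ⁻¹` (Euler evaluation). research route conditional on HC_CM; not a corollary; Q11.4-sentence-2 already refuted in dim ≥ 3. [folklore] -/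
theorem trace_xi_sqrtNegThree_three [IsCyclotomicExtension {21} ℚ K] (hζ : IsPrimitiveRoot ζ 21) :
    Algebra.trace ℚ K ((ζ ^ 5 * (aeval ζ (derivative (cyclotomic 21 ℚ)))⁻¹) * (1 + 2 * ζ ^ 7) * (ζ + ζ⁻¹) ^ 3) = 12 := by
  have hΦ := cyc_twentyOne hζ
  rw [trace_of_key hζ (C (-6 : ℚ) + C (-2 : ℚ) * X + C (7 : ℚ) * X ^ 2 + C (-6 : ℚ) * X ^ 3 + C (3 : ℚ) * X ^ 4 +
      C (6 : ℚ) * X ^ 5 + C (-3 : ℚ) * X ^ 6 + C (-6 : ℚ) * X ^ 7 + C (5 : ℚ) * X ^ 8 + C (2 : ℚ) * X ^ 9 +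
      C (-6 : ℚ) * X ^ 10 + C (12 : ℚ) * X ^ 11) (by compute_degree) (by
    rw [aeval_poly₁₂]
    push_cast
    linear_combination ((aeval ζ (derivative (cyclotomic 21 ℚ)))⁻¹ * (6 * ζ^3 + 8 * ζ^4 + 2 * ζ^5 + 2 * ζ^6)) * hΦ)]
  norm_num [coeff_X_pow, coeff_X, coeff_C, coeff_one]

/-- `Tr(ζ′sθ^4) = 12` for `ζ′ = ξ = ζ⁵/Φ₂₁′(ζ)`, `s = √−3 = 1 + 2ζ⁷`, `θ = ζ + ζ⁻¹` (Euler evaluation). research route conditional on HC_CM; not a corollary; Q11.4-sentence-2 already refuted in dim ≥ 3. [folklore] -/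
theorem trace_xi_sqrtNegThree_four [IsCyclotomicExtension {21} ℚ K] (hζ : IsPrimitiveRoot ζ 21) :
    Algebra.trace ℚ K ((ζ ^ 5 * (aeval ζ (derivative (cyclotomic 21 ℚ)))⁻¹) * (1 + 2 * ζ ^ 7) * (ζ + ζ⁻¹) ^ 4) = 12 := by
  have hΦ := cyc_twentyOne hζ
  rw [trace_of_key hζ (C (-20 : ℚ) + C (13 : ℚ) * X + C (-2 : ℚ) * X ^ 2 + C (-8 : ℚ) * X ^ 3 + C (12 : ℚ) * X ^ 4 +
      C (6 : ℚ) * X ^ 5 + C (-12 : ℚ) * X ^ 6 + C (-4 : ℚ) * X ^ 7 + C (14 : ℚ) * X ^ 8 + C (-13 : ℚ) * X ^ 9 +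
      C (8 : ℚ) * X ^ 10 + C (12 : ℚ) * X ^ 11) (by compute_degree) (by
    rw [aeval_poly₁₂]
    push_cast
    linear_combination ((aeval ζ (derivative (cyclotomic 21 ℚ)))⁻¹ * (20 * ζ^4 + 8 * ζ^5 + 10 * ζ^6 + 2 * ζ^7 + 2 * ζ^8)) * hΦ)]
  norm_num [coeff_X_pow, coeff_X, coeff_C, coeff_one]

/-- `Tr(ζ′sθ^5) = 40` for `ζ′ = ξ = ζ⁵/Φ₂₁′(ζ)`, `s = √−3 = 1 + 2ζ⁷`, `θ = ζ + ζ⁻¹` (Euler evaluation). research route conditional on HC_CM; not a corollary; Q11.4-sentence-2 already refuted in dim ≥ 3. [folklore] -/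
theorem trace_xi_sqrtNegThree_five [IsCyclotomicExtension {21} ℚ K] (hζ : IsPrimitiveRoot ζ 21) :
    Algebra.trace ℚ K ((ζ ^ 5 * (aeval ζ (derivative (cyclotomic 21 ℚ)))⁻¹) * (1 + 2 * ζ ^ 7) * (ζ + ζ⁻¹) ^ 5) = 40 := by
  have h21 : ζ ^ 21 = 1 := hζ.pow_eq_one
  have hΦ := cyc_twentyOne hζ
  rw [trace_of_key hζ (C (-19 : ℚ) + C (-10 : ℚ) * X + C (25 : ℚ) * X ^ 2 + C (-22 : ℚ) * X ^ 3 + C (10 : ℚ) * X ^ 4 +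
      C (20 : ℚ) * X ^ 5 + C (-10 : ℚ) * X ^ 6 + C (-18 : ℚ) * X ^ 7 + C (15 : ℚ) * X ^ 8 + C (10 : ℚ) * X ^ 9 +
      C (-21 : ℚ) * X ^ 10 + C (40 : ℚ) * X ^ 11) (by compute_degree) (by
    rw [aeval_poly₁₂]
    push_cast
    linear_combination ((aeval ζ (derivative (cyclotomic 21 ℚ)))⁻¹ * (2 * ζ + 2 * ζ^2 + 2 * ζ^3 + 20 * ζ^5 + 30 * ζ^6 + 10 * ζ^7 + 10 * ζ^8)) * hΦ +
      ((aeval ζ (derivative (cyclotomic 21 ℚ)))⁻¹ * (2 * ζ)) * h21)]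
  norm_num [coeff_X_pow, coeff_X, coeff_C, coeff_one]

/-- `Tr(ζ′sθ^6) = 38` for `ζ′ = ξ = ζ⁵/Φ₂₁′(ζ)`, `s = √−3 = 1 + 2ζ⁷`, `θ = ζ + ζ⁻¹` (Euler evaluation). research route conditional on HC_CM; not a corollary; Q11.4-sentence-2 already refuted in dim ≥ 3. [folklore] -/
theorem trace_xi_sqrtNegThree_six [IsCyclotomicExtension {21} ℚ K] (hζ : IsPrimitiveRoot ζ 21) :
    Algebra.trace ℚ K ((ζ ^ 5 * (aeval ζ (derivative (cyclotomic 21 ℚ)))⁻¹) * (1 + 2 * ζ ^ 7) * (ζ + ζ⁻¹) ^ 6) = 38 := by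
  have h21 : ζ ^ 21 = 1 := hζ.pow_eq_one
  have hΦ := cyc_twentyOne hζ
  rw [trace_of_key hζ (C (-69 : ℚ) + C (46 : ℚ) * X + C (-13 : ℚ) * X ^ 2 + C (-24 : ℚ) * X ^ 3 + C (38 : ℚ) * X ^ 4 +
      C (19 : ℚ) * X ^ 5 + C (-38 : ℚ) * X ^ 6 + C (-14 : ℚ) * X ^ 7 + C (51 : ℚ) * X ^ 8 + C (-46 : ℚ) * X ^ 9 +
      C (31 : ℚ) * X ^ 10 + C (38 : ℚ) * X ^ 11) (by compute_degree) (by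
    rw [aeval_poly₁₂]
    push_cast
    linear_combination ((aeval ζ (derivative (cyclotomic 21 ℚ)))⁻¹ * (12 * ζ + 12 * ζ^2 + 14 * ζ^3 + 2 * ζ^4 + 3 * ζ^5 + 70 * ζ^6 + 30 * ζ^7 +
        30 * ζ^8)) * hΦ +
      ((aeval ζ (derivative (cyclotomic 21 ℚ)))⁻¹ * (12 * ζ + 2 * ζ^3)) * h21)]
  norm_num [coeff_X_pow, coeff_X, coeff_C, coeff_one]

/-- `Tr(ζ′sθ^7) = 138` for `ζ′ = ξ = ζ⁵/Φ₂₁′(ζ)`, `s = √−3 = 1 + 2ζ⁷`, `θ = ζ + ζ⁻¹` (Euler evaluation). research route conditional on HC_CM; not a corollary; Q11.4-sentence-2 already refuted in dim ≥ 3. [folklore] -/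
theorem trace_xi_sqrtNegThree_seven [IsCyclotomicExtension {21} ℚ K] (hζ : IsPrimitiveRoot ζ 21) :
    Algebra.trace ℚ K ((ζ ^ 5 * (aeval ζ (derivative (cyclotomic 21 ℚ)))⁻¹) * (1 + 2 * ζ ^ 7) * (ζ + ζ⁻¹) ^ 7) = 138 := by
  have h21 : ζ ^ 21 = 1 := hζ.pow_eq_one
  have hΦ := cyc_twentyOne hζ
  rw [trace_of_key hζ (C (-61 : ℚ) + C (-44 : ℚ) * X + C (91 : ℚ) * X ^ 2 + C (-82 : ℚ) * X ^ 3 + C (33 : ℚ) * X ^ 4 +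
      C (69 : ℚ) * X ^ 5 + C (-33 : ℚ) * X ^ 6 + C (-56 : ℚ) * X ^ 7 + C (47 : ℚ) * X ^ 8 + C (44 : ℚ) * X ^ 9 +
      C (-77 : ℚ) * X ^ 10 + C (138 : ℚ) * X ^ 11) (by compute_degree) (by
    rw [aeval_poly₁₂]
    push_cast
    linear_combination ((aeval ζ (derivative (cyclotomic 21 ℚ)))⁻¹ * (42 * ζ + 42 * ζ^2 + 56 * ζ^3 + 14 * ζ^4 + 17 * ζ^5 + 3 * ζ^6 + 71 * ζ^7 +
        70 * ζ^8)) * hΦ +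
      ((aeval ζ (derivative (cyclotomic 21 ℚ)))⁻¹ * (42 * ζ + 14 * ζ^3 + 2 * ζ^5)) * h21)]
  norm_num [coeff_X_pow, coeff_X, coeff_C, coeff_one]

/-- `Tr(ζ′sθ^8) = 122` for `ζ′ = ξ = ζ⁵/Φ₂₁′(ζ)`, `s = √−3 = 1 + 2ζ⁷`, `θ = ζ + ζ⁻¹` (Euler evaluation). research route conditional on HC_CM; not a corollary; Q11.4-sentence-2 already refuted in dim ≥ 3. [folklore] -/
theorem trace_xi_sqrtNegThree_eight [IsCyclotomicExtension {21} ℚ K] (hζ : IsPrimitiveRoot ζ 21) :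
    Algebra.trace ℚ K ((ζ ^ 5 * (aeval ζ (derivative (cyclotomic 21 ℚ)))⁻¹) * (1 + 2 * ζ ^ 7) * (ζ + ζ⁻¹) ^ 8) = 122 := by
  have h21 : ζ ^ 21 = 1 := hζ.pow_eq_one
  have hΦ := cyc_twentyOne hζ
  rw [trace_of_key hζ (C (-243 : ℚ) + C (168 : ℚ) * X + C (-65 : ℚ) * X ^ 2 + C (-75 : ℚ) * X ^ 3 + C (125 : ℚ) * X ^ 4 +
      C (61 : ℚ) * X ^ 5 + C (-125 : ℚ) * X ^ 6 + C (-47 : ℚ) * X ^ 7 + C (187 : ℚ) * X ^ 8 +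
      C (-168 : ℚ) * X ^ 9 + C (121 : ℚ) * X ^ 10 + C (122 : ℚ) * X ^ 11) (by compute_degree) (by
    rw [aeval_poly₁₂]
    push_cast
    linear_combination ((aeval ζ (derivative (cyclotomic 21 ℚ)))⁻¹ * (1 + 113 * ζ + 113 * ζ^2 + 168 * ζ^3 + 56 * ζ^4 + 73 * ζ^5 + 17 * ζ^6 +
        26 * ζ^7 + 140 * ζ^8)) * hΦ +
      ((aeval ζ (derivative (cyclotomic 21 ℚ)))⁻¹ * (1 + 112 * ζ + 56 * ζ^3 + 16 * ζ^5 + 2 * ζ^7)) * h21)]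
  norm_num [coeff_X_pow, coeff_X, coeff_C, coeff_one]

/-- `Tr(ζ′sθ^9) = 486` for `ζ′ = ξ = ζ⁵/Φ₂₁′(ζ)`, `s = √−3 = 1 + 2ζ⁷`, `θ = ζ + ζ⁻¹` (Euler evaluation). research route conditional on HC_CM; not a corollary; Q11.4-sentence-2 already refuted in dim ≥ 3. [folklore] -/
theorem trace_xi_sqrtNegThree_nine [IsCyclotomicExtension {21} ℚ K] (hζ : IsPrimitiveRoot ζ 21) :
    Algebra.trace ℚ K ((ζ ^ 5 * (aeval ζ (derivative (cyclotomic 21 ℚ)))⁻¹) * (1 + 2 * ζ ^ 7) * (ζ + ζ⁻¹) ^ 9) = 486 := by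
  have h21 : ζ ^ 21 = 1 := hζ.pow_eq_one
  have hΦ := cyc_twentyOne hζ
  rw [trace_of_key hζ (C (-197 : ℚ) + C (-186 : ℚ) * X + C (336 : ℚ) * X ^ 2 + C (-305 : ℚ) * X ^ 3 + C (108 : ℚ) * X ^ 4 +
      C (243 : ℚ) * X ^ 5 + C (-108 : ℚ) * X ^ 6 + C (-181 : ℚ) * X ^ 7 + C (150 : ℚ) * X ^ 8 +
      C (186 : ℚ) * X ^ 9 + C (-289 : ℚ) * X ^ 10 + C (486 : ℚ) * X ^ 11) (by compute_degree) (by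
    rw [aeval_poly₁₂]
    push_cast
    linear_combination ((aeval ζ (derivative (cyclotomic 21 ℚ)))⁻¹ * (9 + 261 * ζ + 262 * ζ^2 + 421 * ζ^3 + 169 * ζ^4 + 241 * ζ^5 + 73 * ζ^6 +
        91 * ζ^7 - 234 * ζ^8)) * hΦ +
      ((aeval ζ (derivative (cyclotomic 21 ℚ)))⁻¹ * (9 + 252 * ζ + ζ^2 + 168 * ζ^3 + 72 * ζ^5 + 18 * ζ^7 + 2 * ζ^9)) * h21)]
  norm_num [coeff_X_pow, coeff_X, coeff_C, coeff_one]

/-- `Tr(ζ′sθ^10) = 394` for `ζ′ = ξ = ζ⁵/Φ₂₁′(ζ)`, `s = √−3 = 1 + 2ζ⁷`, `θ = ζ + ζ⁻¹` (Euler evaluation). research route conditional on HC_CM; not a corollary; Q11.4-sentence-2 already refuted in dim ≥ 3. [folklore] -/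
theorem trace_xi_sqrtNegThree_ten [IsCyclotomicExtension {21} ℚ K] (hζ : IsPrimitiveRoot ζ 21) :
    Algebra.trace ℚ K ((ζ ^ 5 * (aeval ζ (derivative (cyclotomic 21 ℚ)))⁻¹) * (1 + 2 * ζ ^ 7) * (ζ + ζ⁻¹) ^ 10) = 394 := by
  have h21 : ζ ^ 21 = 1 := hζ.pow_eq_one
  have hΦ := cyc_twentyOne hζ
  rw [trace_of_key hζ (C (-869 : ℚ) + C (625 : ℚ) * X + C (-294 : ℚ) * X ^ 2 + C (-239 : ℚ) * X ^ 3 + C (424 : ℚ) * X ^ 4 +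
      C (197 : ℚ) * X ^ 5 + C (-424 : ℚ) * X ^ 6 + C (-155 : ℚ) * X ^ 7 + C (688 : ℚ) * X ^ 8 +
      C (-625 : ℚ) * X ^ 9 + C (475 : ℚ) * X ^ 10 + C (394 : ℚ) * X ^ 11) (by compute_degree) (by
    rw [aeval_poly₁₂]
    push_cast
    linear_combination ((aeval ζ (derivative (cyclotomic 21 ℚ)))⁻¹ * (-349 + 155 * ζ + 165 * ζ^2 + 934 * ζ^3 + 431 * ζ^4 + 662 * ζ^5 +
        242 * ζ^6 + 690 * ζ^7 - 55 * ζ^8)) * hΦ +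
      ((aeval ζ (derivative (cyclotomic 21 ℚ)))⁻¹ * (-349 + 504 * ζ + 10 * ζ^2 + 420 * ζ^3 + ζ^4 + 240 * ζ^5 + 90 * ζ^7 +
        20 * ζ^9 + 2 * ζ^11)) * h21)]
  norm_num [coeff_X_pow, coeff_X, coeff_C, coeff_one]

/-- **The Gram datum `a` of `(E_ζ′, s)` in the real frame `θ^i` (`i < 6`)** for `ζ′ = ξ = ζ⁵/Φ₂₁′(ζ)` (principal type (1)),
`s = √−3 = 1 + 2ζ⁷`: the integer Hankel matrix `(−Tr(ζ′sθ^{i+j}))ᵢⱼ` (and `b = 0`, part 82 `hb_eq_zero`).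
research route conditional on HC_CM; not a corollary; Q11.4-sentence-2 already refuted in dim ≥ 3. [cite: vanGeemen1994HodgeAV, Lemma 5.2 (2)–(3)] -/
theorem realPart_xi_sqrtNegThree [IsCyclotomicExtension {21} ℚ K] [IsCMField K] (hζ : IsPrimitiveRoot ζ 21)
    {x : Fin 6 → K} (hx : ∀ i, x i = (ζ + ζ⁻¹) ^ (i : ℕ)) {a : Matrix (Fin 6) (Fin 6) ℚ}
    (ha : ∀ i j, a i j = Algebra.trace ℚ K ((ζ ^ 5 * (aeval ζ (derivative (cyclotomic 21 ℚ)))⁻¹) * x i * IsCMField.complexConj K ((1 + 2 * ζ ^ 7) * x j))) :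
    a = !![-2, -4, -4, -12, -12, -40; -4, -4, -12, -12, -40, -38; -4, -12, -12, -40, -38, -138; -12, -12, -40, -38, -138, -122; -12, -40, -38, -138, -122, -486; -40, -38, -138, -122, -486, -394] := by
  rw [ha_eq (complexConj_sqrtNegThree hζ) (complexConj_thetaFrame hζ hx) ha]
  ext i j
  simp only [Matrix.of_apply, hx, ← pow_add]
  fin_cases i <;> fin_cases j <;> simp [trace_xi_sqrtNegThree_zero hζ, trace_xi_sqrtNegThree_one hζ, trace_xi_sqrtNegThree_two hζ, trace_xi_sqrtNegThree_three hζ, trace_xi_sqrtNegThree_four hζ, trace_xi_sqrtNegThree_five hζ,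
    trace_xi_sqrtNegThree_six hζ, trace_xi_sqrtNegThree_seven hζ, trace_xi_sqrtNegThree_eight hζ, trace_xi_sqrtNegThree_nine hζ, trace_xi_sqrtNegThree_ten hζ]

/-- **`det a = 1728`** for `ζ′ = ξ = ζ⁵/Φ₂₁′(ζ)`, `s = √−3 = 1 + 2ζ⁷` (frame `θ^i`, `i < 6`). research route conditional on HC_CM; not a corollary; Q11.4-sentence-2 already refuted in dim ≥ 3. [cite: vanGeemen1994HodgeAV, Lemma 5.2 (3)] -/
theorem det_realPart_xi_sqrtNegThree [IsCyclotomicExtension {21} ℚ K] [IsCMField K] (hζ : IsPrimitiveRoot ζ 21)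
    {x : Fin 6 → K} (hx : ∀ i, x i = (ζ + ζ⁻¹) ^ (i : ℕ)) {a : Matrix (Fin 6) (Fin 6) ℚ}
    (ha : ∀ i j, a i j = Algebra.trace ℚ K ((ζ ^ 5 * (aeval ζ (derivative (cyclotomic 21 ℚ)))⁻¹) * x i * IsCMField.complexConj K ((1 + 2 * ζ ^ 7) * x j))) :
    a.det = 1728 := by
  rw [realPart_xi_sqrtNegThree hζ hx ha]
  simp [Matrix.det_succ_row_zero, Fin.sum_univ_succ, Fin.succAbove, Matrix.submatrix]
  norm_num

end Summit.HodgeConjecture.Ring2WeilCoverage.WeilGramLevel21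

end
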